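import Mathlib
import Summits.KontsevichZagierPeriods.KontsevichZagierPeriods.Theses.SymplecticScissors
import Summits.KontsevichZagierPeriods.KontsevichZagierPeriods.Theorems.SymplecticScissorsVolumeFormStackReduction
import Literature.NumberTheory.Transcendental.KZCalculusProofs
import Literature.NumberTheory.Transcendental.SemialgebraicMapsProofs
import Literature.NumberTheory.Transcendental.KZSemiCanonicalReductionProofs

/-!
# `VolumeForm` (stmt-KontsevichZagierPeriods-3814), line `Sketch` — stub `stub_stackUnionReduction`

**Stack-union reduction.** A finite pairwise disjoint union `r = [⋃ᵢ Sᵢ, 1]` of `k` triangular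
stacks `Sᵢ ⊂ ℝ³` over one parameter interval `(a, b)` (each swept by the open triangle with
`ℚ`-semialgebraic `C¹` vertex curves `vᵢ₀ t, vᵢ₁ t, vᵢ₂ t` and slice determinant `Dᵢ t ≠ 0`) is
KZ-equivalent to the integrand-`1` planar representation on the subgraph
`{(t, σ) | a < t < b, 0 < σ < ∑ᵢ |Dᵢ t| / 2}` of half the sum of the slice determinants, GIVEN the
merging of finitely many planar subgraphs over `(a, b)` into the subgraph of the sum (hypothesis
`STACKING`, the neighbouring stub `stub_subgraphStacking`). Pure bookkeeping:
* each stack `Sᵢ` is `ℚ`-semialgebraic (image of the open prism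
  `(a, b) × {l, m > 0, l + m < 1}` under the affine-in-`(l, m)` semialgebraic chart;
  Tarski–Seidenberg), so `rᵢ = r|Sᵢ` is a representation and rule (1a) over the finite disjoint
  partition gives `[r] − ∑ᵢ [rᵢ] ∈ relations` (`KZ.of_sub_sum_of_mem_relations`);
* each `rᵢ` is reduced to its planar subgraph `sᵢ` by the landed one-stack transfer lemma
  `stub_stackReduction` (rules (2), (1), (3));
* `STACKING` merges the `sᵢ` (the functions `|Dᵢ| / 2` are semialgebraic, `C¹` since `Dᵢ ≠ 0`,
  and non-negative), and the three relations are chained in the formal group.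
Sources: M. Kontsevich, D. Zagier, *Periods* (2001), §1.2 rules (1)–(3); J. Bochnak, M. Coste,
M.-F. Roy, *Real Algebraic Geometry* (1998), §2.2 (semialgebraic maps and images); folklore.
-/

noncomputable section

open scoped BigOperators
open Set MeasureTheory MvPolynomial
open Literature.NumberTheory.Transcendental
open Literature.ModelTheory.ExponentialFields (IsSemialgebraic)

namespace Summit.KontsevichZagierPeriods.SymplecticScissors.VolumeForm

/-- One triangular stack `{(t, v₀ t + l (v₁ t − v₀ t) + m (v₂ t − v₀ t)) | a < t < b, l, m > 0,
l + m < 1}` with `ℚ`-semialgebraic vertex curves is a `ℚ`-semialgebraic subset of `ℝ³`: it is the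
image of the open semialgebraic prism `(a, b) × {l, m > 0, l + m < 1}` under the semialgebraic chart
`(t, l, m) ↦ (t, v₀ t + l (v₁ t − v₀ t) + m (v₂ t − v₀ t))` (Tarski–Seidenberg).
[cite: BochnakCosteRoy1998, Prop. 2.2.7] -/
theorem stackUnion_isSemialgebraic_stack {a b : ℝ} {v : Fin 3 → ℝ → Fin 2 → ℝ}
    (hsa : ∀ j, IsSemialgebraicMapOn ℚ {z : Fin 1 → ℝ | z 0 ∈ Set.Ioo a b} (fun z => v j (z 0))) :
    IsSemialgebraic ℚ {p : Fin 3 → ℝ | p 0 ∈ Set.Ioo a b ∧ ∃ l m : ℝ, 0 < l ∧ 0 < m ∧ l + m < 1 ∧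
      p 1 = v 0 (p 0) 0 + l * (v 1 (p 0) 0 - v 0 (p 0) 0) + m * (v 2 (p 0) 0 - v 0 (p 0) 0) ∧
      p 2 = v 0 (p 0) 1 + l * (v 1 (p 0) 1 - v 0 (p 0) 1) + m * (v 2 (p 0) 1 - v 0 (p 0) 1)} := by
  set I : Set (Fin 1 → ℝ) := {z | z 0 ∈ Ioo a b} with hI_def
  have hI : IsSemialgebraic ℚ I := IsSemialgebraicMapOn.isSemialgebraic_holds (hsa 0)
  have g : ∀ j i, IsSemialgebraicFunOn ℚ I (fun z => v j (z 0) i) := fun j i =>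
    (isSemialgebraicMapOn_iff_forall_holds hI).1 (hsa j) i
  -- the open prism
  set W : Set (Fin 3 → ℝ) := {w | w 0 ∈ Ioo a b ∧ 0 < w 1 ∧ 0 < w 2 ∧ w 1 + w 2 < 1} with hW_def
  have hW : IsSemialgebraic ℚ W := by
    have h0 : IsSemialgebraic ℚ {w : Fin 3 → ℝ | w 0 ∈ Ioo a b} :=
      hI.preimage_comp (fun _ : Fin 1 => (0 : Fin 3))
    have h1 : IsSemialgebraic ℚ {w : Fin 3 → ℝ | 0 < w 1} := by
      simpa using Literature.ModelTheory.ExponentialFields.isSemialgebraic_setOf_eval_pos (k := ℚ)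
        (R := ℝ) (X 1 : MvPolynomial (Fin 3) ℚ)
    have h2 : IsSemialgebraic ℚ {w : Fin 3 → ℝ | 0 < w 2} := by
      simpa using Literature.ModelTheory.ExponentialFields.isSemialgebraic_setOf_eval_pos (k := ℚ)
        (R := ℝ) (X 2 : MvPolynomial (Fin 3) ℚ)
    have h3 : IsSemialgebraic ℚ {w : Fin 3 → ℝ | w 1 + w 2 < 1} := by
      have h := Literature.ModelTheory.ExponentialFields.isSemialgebraic_setOf_eval_lt (k := ℚ)
        (R := ℝ) (X 1 + X 2 : MvPolynomial (Fin 3) ℚ) 1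
      simp only [map_add, MvPolynomial.aeval_X, map_one] at h
      exact h
    convert ((h0.inter h1).inter h2).inter h3 using 1
    ext w
    simp only [hW_def, mem_setOf_eq, mem_inter_iff, and_assoc]
  -- the affine chart
  set Φ : (Fin 3 → ℝ) → (Fin 3 → ℝ) := fun w => ![w 0,
    v 0 (w 0) 0 + w 1 * (v 1 (w 0) 0 - v 0 (w 0) 0) + w 2 * (v 2 (w 0) 0 - v 0 (w 0) 0),
    v 0 (w 0) 1 + w 1 * (v 1 (w 0) 1 - v 0 (w 0) 1) + w 2 * (v 2 (w 0) 1 - v 0 (w 0) 1)] with hΦ_def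
  have hΦ : IsSemialgebraicMapOn ℚ W Φ := by
    have hmI : ∀ w ∈ W, (fun _ : Fin 1 => w 0) ∈ I := fun w hw => hw.1
    have c : ∀ j i, IsSemialgebraicFunOn ℚ W (fun w => v j (w 0) i) :=
      fun j i => stackRed_comp_apply hW 0 (g j i) hmI
    have hc : ∀ i, IsSemialgebraicFunOn ℚ W (fun w =>
        v 0 (w 0) i + w 1 * (v 1 (w 0) i - v 0 (w 0) i) + w 2 * (v 2 (w 0) i - v 0 (w 0) i)) :=
      fun i => (IsSemialgebraicFunOn.add_holds (IsSemialgebraicFunOn.add_holds (c 0 i)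
        (IsSemialgebraicFunOn.mul_holds (isSemialgebraicFunOn_apply hW 1)
          (IsSemialgebraicFunOn.sub_holds (c 1 i) (c 0 i))))
        (IsSemialgebraicFunOn.mul_holds (isSemialgebraicFunOn_apply hW 2)
          (IsSemialgebraicFunOn.sub_holds (c 2 i) (c 0 i)))).congr fun w _ => by
        simp only [Pi.add_apply, Pi.mul_apply, Pi.sub_apply]
    refine IsSemialgebraicMapOn.of_forall hW fun j => ?_
    fin_cases j
    · exact (isSemialgebraicFunOn_apply hW 0).congr fun w _ => by simp [hΦ_def]
    · exact (hc 0).congr fun w _ => by simp [hΦ_def]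
    · exact (hc 1).congr fun w _ => by simp [hΦ_def]
  convert IsSemialgebraicMapOn.isSemialgebraic_image_holds hΦ Subset.rfl hW using 1
  ext p
  simp only [mem_setOf_eq, mem_image]
  constructor
  · rintro ⟨ht, l, m, hl, hm, hlm, h1, h2⟩
    refine ⟨![p 0, l, m], ?_, ?_⟩
    · simp only [hW_def, mem_setOf_eq, Matrix.cons_val_zero, Matrix.cons_val_one, Matrix.head_cons,
        Matrix.cons_val_two, Matrix.tail_cons]
      exact ⟨ht, hl, hm, hlm⟩
    · funext j
      fin_cases j
      · simp [hΦ_def]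
      · simp [hΦ_def, h1]
      · simp [hΦ_def, h2]
  · rintro ⟨w, ⟨ht, hl, hm, hlm⟩, rfl⟩
    exact ⟨ht, w 1, w 2, hl, hm, hlm, by simp [hΦ_def], by simp [hΦ_def]⟩

/-- Half the absolute slice determinant `t ↦ |D t| / 2` of a triangular stack with
`ℚ`-semialgebraic vertex curves is a `ℚ`-semialgebraic function of `t ∈ (a, b)` (sums, products,
absolute value of semialgebraic functions; Tarski–Seidenberg).
[cite: BochnakCosteRoy1998, Prop. 2.2.6] -/
theorem stackUnion_isSemialgebraicFunOn_halfAbsDet {a b : ℝ} {v : Fin 3 → ℝ → Fin 2 → ℝ}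
    (hsa : ∀ j, IsSemialgebraicMapOn ℚ {z : Fin 1 → ℝ | z 0 ∈ Set.Ioo a b} (fun z => v j (z 0))) :
    IsSemialgebraicFunOn ℚ {z : Fin 1 → ℝ | z 0 ∈ Set.Ioo a b}
      (fun z => |(v 1 (z 0) 0 - v 0 (z 0) 0) * (v 2 (z 0) 1 - v 0 (z 0) 1)
        - (v 1 (z 0) 1 - v 0 (z 0) 1) * (v 2 (z 0) 0 - v 0 (z 0) 0)| / 2) := by
  have hI : IsSemialgebraic ℚ {z : Fin 1 → ℝ | z 0 ∈ Set.Ioo a b} :=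
    IsSemialgebraicMapOn.isSemialgebraic_holds (hsa 0)
  have g : ∀ j i, IsSemialgebraicFunOn ℚ {z : Fin 1 → ℝ | z 0 ∈ Set.Ioo a b}
      (fun z => v j (z 0) i) := fun j i => (isSemialgebraicMapOn_iff_forall_holds hI).1 (hsa j) i
  have hD := IsSemialgebraicFunOn.sub_holds
    (IsSemialgebraicFunOn.mul_holds (IsSemialgebraicFunOn.sub_holds (g 1 0) (g 0 0))
      (IsSemialgebraicFunOn.sub_holds (g 2 1) (g 0 1)))
    (IsSemialgebraicFunOn.mul_holds (IsSemialgebraicFunOn.sub_holds (g 1 1) (g 0 1))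
      (IsSemialgebraicFunOn.sub_holds (g 2 0) (g 0 0)))
  refine (IsSemialgebraicFunOn.mul_holds hD.abs (isSemialgebraicFunOn_ratCast hI (1 / 2))).congr
    fun z _ => ?_
  simp only [Pi.mul_apply, Pi.sub_apply]
  push_cast
  ring

/-- Half the absolute slice determinant `t ↦ |D t| / 2` of a triangular stack with `C¹` vertex
curves and `D ≠ 0` on `(a, b)` is `C¹` on `(a, b)` (the absolute value is smooth off `0`).
[folklore] -/
theorem stackUnion_contDiffOn_halfAbsDet {a b : ℝ} {v : Fin 3 → ℝ → Fin 2 → ℝ}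
    (hc : ∀ j, ContDiffOn ℝ 1 (v j) (Set.Ioo a b))
    (hdet : ∀ t ∈ Set.Ioo a b, (v 1 t 0 - v 0 t 0) * (v 2 t 1 - v 0 t 1)
      - (v 1 t 1 - v 0 t 1) * (v 2 t 0 - v 0 t 0) ≠ 0) :
    ContDiffOn ℝ 1 (fun t => |(v 1 t 0 - v 0 t 0) * (v 2 t 1 - v 0 t 1)
      - (v 1 t 1 - v 0 t 1) * (v 2 t 0 - v 0 t 0)| / 2) (Set.Ioo a b) := by
  have h : ∀ j i, ContDiffOn ℝ 1 (fun t => v j t i) (Set.Ioo a b) := fun j i =>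
    contDiffOn_pi.1 (hc j) i
  exact (((((h 1 0).sub (h 0 0)).mul ((h 2 1).sub (h 0 1))).sub
    (((h 1 1).sub (h 0 1)).mul ((h 2 0).sub (h 0 0)))).abs hdet).div_const 2

/-- **Stack-union reduction.** Given the merging of finitely many integrand-`1` planar subgraphs
over one interval into the subgraph of the sum (`STACKING`), a finite pairwise disjoint union `r`
of `k` triangular stacks over `(a, b)` (vertices `ℚ`-semialgebraic and `C¹`, slice determinants
`Dᵢ ≠ 0`, integrand `1`) is KZ-equivalent to an integrand-`1` representation on the planar subgraph
`{(t, σ) | a < t < b, 0 < σ < ∑ᵢ |Dᵢ t| / 2}`, which exists: split `r` over the stacks by rule (1a)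
(`KZ.of_sub_sum_of_mem_relations`), reduce each stack by `stub_stackReduction`, merge by
`STACKING`, and chain the relations. [cite: KontsevichZagier2001, §1.2 rules (1)–(3)] -/
theorem stub_stackUnionReduction :
    (∀ (k : ℕ) (a b : ℝ) (α : Fin k → ℝ → ℝ) (S : Fin k → KZ.IntegralRep 2),
      a < b →
      (∀ i, IsSemialgebraicFunOn ℚ {z : Fin 1 → ℝ | z 0 ∈ Set.Ioo a b} (fun z => α i (z 0))) →
      (∀ i, ContDiffOn ℝ 1 (α i) (Set.Ioo a b)) →
      (∀ i, ∀ t ∈ Set.Ioo a b, 0 ≤ α i t) →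
      (∀ i, (S i).domain = {q | q 0 ∈ Set.Ioo a b ∧ 0 < q 1 ∧ q 1 < α i (q 0)}) →
      (∀ i, ∀ q ∈ (S i).domain, (S i).integrand q = 1) →
      ∃ T : KZ.IntegralRep 2,
        T.domain = {q | q 0 ∈ Set.Ioo a b ∧ 0 < q 1 ∧ q 1 < ∑ i, α i (q 0)} ∧
        (∀ q ∈ T.domain, T.integrand q = 1) ∧ KZ.of T - ∑ i, KZ.of (S i) ∈ KZ.relations) →
    ∀ (k : ℕ) (a b : ℝ) (V : Fin k → Fin 3 → ℝ → Fin 2 → ℝ)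
    (r : KZ.IntegralRep 3),
    a < b →
    (∀ i j, IsSemialgebraicMapOn ℚ {z : Fin 1 → ℝ | z 0 ∈ Set.Ioo a b} (fun z => V i j (z 0))) →
    (∀ i j, ContDiffOn ℝ 1 (V i j) (Set.Ioo a b)) →
    (∀ i, ∀ t ∈ Set.Ioo a b, (V i 1 t 0 - V i 0 t 0) * (V i 2 t 1 - V i 0 t 1)
      - (V i 1 t 1 - V i 0 t 1) * (V i 2 t 0 - V i 0 t 0) ≠ 0) →
    (∀ i i', i ≠ i' → Disjoint
      {p : Fin 3 → ℝ | p 0 ∈ Set.Ioo a b ∧ ∃ l m : ℝ, 0 < l ∧ 0 < m ∧ l + m < 1 ∧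
        p 1 = V i 0 (p 0) 0 + l * (V i 1 (p 0) 0 - V i 0 (p 0) 0) + m * (V i 2 (p 0) 0 - V i 0 (p 0) 0) ∧
        p 2 = V i 0 (p 0) 1 + l * (V i 1 (p 0) 1 - V i 0 (p 0) 1) + m * (V i 2 (p 0) 1 - V i 0 (p 0) 1)}
      {p : Fin 3 → ℝ | p 0 ∈ Set.Ioo a b ∧ ∃ l m : ℝ, 0 < l ∧ 0 < m ∧ l + m < 1 ∧
        p 1 = V i' 0 (p 0) 0 + l * (V i' 1 (p 0) 0 - V i' 0 (p 0) 0) + m * (V i' 2 (p 0) 0 - V i' 0 (p 0) 0) ∧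
        p 2 = V i' 0 (p 0) 1 + l * (V i' 1 (p 0) 1 - V i' 0 (p 0) 1) + m * (V i' 2 (p 0) 1 - V i' 0 (p 0) 1)}) →
    r.domain = ⋃ i, {p : Fin 3 → ℝ | p 0 ∈ Set.Ioo a b ∧ ∃ l m : ℝ, 0 < l ∧ 0 < m ∧ l + m < 1 ∧
        p 1 = V i 0 (p 0) 0 + l * (V i 1 (p 0) 0 - V i 0 (p 0) 0) + m * (V i 2 (p 0) 0 - V i 0 (p 0) 0) ∧
        p 2 = V i 0 (p 0) 1 + l * (V i 1 (p 0) 1 - V i 0 (p 0) 1) + m * (V i 2 (p 0) 1 - V i 0 (p 0) 1)} →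
    (∀ p ∈ r.domain, r.integrand p = 1) →
    ∃ s : KZ.IntegralRep 2,
      s.domain = {q | q 0 ∈ Set.Ioo a b ∧ 0 < q 1 ∧
        q 1 < ∑ i, |(V i 1 (q 0) 0 - V i 0 (q 0) 0) * (V i 2 (q 0) 1 - V i 0 (q 0) 1)
          - (V i 1 (q 0) 1 - V i 0 (q 0) 1) * (V i 2 (q 0) 0 - V i 0 (q 0) 0)| / 2} ∧
      (∀ q ∈ s.domain, s.integrand q = 1) ∧ KZ.Equivalent r s := by
  intro STACKING k a b V r hab hsa hc hdet hdisj hr hri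
  -- the stacks are semialgebraic pieces of `r.domain`
  have hSsa := fun i => stackUnion_isSemialgebraic_stack (hsa i)
  have hsub := fun i : Fin k => ((subset_iUnion _ i).trans hr.symm.subset : _ ⊆ r.domain)
  set R : Fin k → KZ.IntegralRep 3 := fun i => r.restrict _ (hSsa i) (hsub i) with hR
  -- rule (1a) over the finite disjoint partition
  have e1 : KZ.of r - ∑ i, KZ.of (R i) ∈ KZ.relations := by
    refine KZ.of_sub_sum_of_mem_relations Finset.univ r R (fun i _ => ?_) (fun _ _ _ _ => rfl) ?_
      fun i _ j _ hij => ?_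
    · rw [show (R i).domain \ r.domain = ∅ from Set.sdiff_eq_empty.mpr (hsub i), measure_empty]
    · have : r.domain \ (⋃ i ∈ (Finset.univ : Finset (Fin k)), (R i).domain) = ∅ := by
        refine Set.sdiff_eq_empty.mpr fun p hp => ?_
        rw [hr, mem_iUnion] at hp
        obtain ⟨i, hi⟩ := hp
        exact mem_iUnion₂.mpr ⟨i, Finset.mem_univ i, hi⟩
      rw [this, measure_empty]
    · show volume ((R i).domain ∩ (R j).domain) = 0
      rw [show (R i).domain ∩ (R j).domain = ∅ from
        Set.disjoint_iff_inter_eq_empty.mp (hdisj i j hij), measure_empty]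
  -- each stack is reduced to its planar subgraph
  have hex := fun i => stub_stackReduction a b (V i) (R i) hab (hsa i) (hc i) (hdet i) rfl
    fun p hp => hri p (hsub i hp)
  choose s hs using hex
  have e2 : ∑ i, KZ.of (R i) - ∑ i, KZ.of (s i) ∈ KZ.relations :=
    KZ.sum_sub_sum_mem_relations Finset.univ _ _ fun i _ => (hs i).2.2
  -- merge the planar subgraphs
  obtain ⟨T, hTd, hTi, e3⟩ := STACKING k a b
    (fun i t => |(V i 1 t 0 - V i 0 t 0) * (V i 2 t 1 - V i 0 t 1)
      - (V i 1 t 1 - V i 0 t 1) * (V i 2 t 0 - V i 0 t 0)| / 2) s hab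
    (fun i => stackUnion_isSemialgebraicFunOn_halfAbsDet (hsa i))
    (fun i => stackUnion_contDiffOn_halfAbsDet (hc i) (hdet i)) (fun i t _ => by positivity)
    (fun i => (hs i).1) (fun i => (hs i).2.1)
  refine ⟨T, hTd, hTi, ?_⟩
  show KZ.of r - KZ.of T ∈ KZ.relations
  have : KZ.of r - KZ.of T = (KZ.of r - ∑ i, KZ.of (R i)) + (∑ i, KZ.of (R i) - ∑ i, KZ.of (s i))
      - (KZ.of T - ∑ i, KZ.of (s i)) := by abel
  rw [this]
  exact KZ.relations.sub_mem (KZ.relations.add_mem e1 e2) e3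

end Summit.KontsevichZagierPeriods.SymplecticScissors.VolumeForm

end
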